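/-
Copyright (c) 2026 the pub-hodgecm-mathlib formalisation cell (harness21).  Prover seat hodgecm-mathlib-B-p04 (g35), heir of the (R2) EP pen («EP-RAM-E»: B-p08 (g28)
2026-09-01T09:59Z «the TAME-RAMIFIED corollary … B-p04 (g35) pen»; B-p14 (g32) 09:59Z «EP-RAM-PKG» consumer), 2026-09-01.
-/
import Literature.NumberTheory.Automorphic.UnitaryTwoEulerPoincareEllipticInert          -- ★ B-p08 (g28) p843470: the place-blind `natCard_fixedBy_add_eq_natCard_fixedBy_add_one_of_transitive`
import Literature.NumberTheory.Automorphic.HermitianLatticeTreeTransitiveRamifiedFlags  -- ★ A-p06 (g27) p843469: the ramified (hA)(hB)(hI) `…_of_ramified_antidiag`, `…_of_ramified`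
import Literature.NumberTheory.Automorphic.FixedCosetsFiniteOfCompactCentralizer        -- ★ B-p04 (g35) p843428: the finiteness triple `finite_fixedBy_quotient_and_of_isClosed`
import Literature.NumberTheory.Automorphic.UnitaryUnitOrbitalIntegralFixedPoints        -- ★ `isClosed_conjClass_local_of_isRegularElt`, the `U(H)(L⁺_v)` instances
import HarnessLib

/-!
# Kottwitz's elliptic relation on `U(Φ₂)(L⁺_v)` at a TAMELY RAMIFIED non-split place — type-blind, from the tree (Kottwitz 1988 §2; Bruhat–Tits 1972 §10)

Topic `NumberTheory/Automorphic`; namespace `Literature.NumberTheory.Automorphic.UnitaryGroup`.  THEOREMS ONLY (no definition, no instance, no notation, no named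
fact, no `sorry`); kernel lane.  Cell `pub/hodgecm-mathlib` (D-0151), crux H413 = `stmt-HodgeConjecture-24833`, line «N6nsGerm», stub `stub_N6nsR2EP :
RankOneEulerPoincareNonsplit` [Kottwitz1988 §2 Thm 2], RAMIFIED half (A-p06 (g27) census `CENSUS-R2ram-RamifiedEulerPoincare.A-p06g27.md`; LEAD F0P3a-plan (g10) T9-8 (B)):
the elliptic relation (E) at a tamely ramified place, i.e. the `hE` binder of B-p14 (g32)'s per-place package «EP-RAM-PKG» (`exists_epRelations_of_ramified_of`).
HONEST LABEL: HC_CM is proved only modulo the cell's remaining named inputs (hLiu418, h413) until rung 0 closes; (R2) is a printed theorem and this file discharges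
its elliptic half at the tame ramified places from in-tree facts.

THE MATHEMATICS.  `v` a finite place of `L⁺` RAMIFIED in the CM field `L` (`e(w|v) ≠ 1`) with `2 ∈ 𝒪_w^×` (tame), `w ∣ v`, `ϖ` ANY uniformiser of `L_w` (e.g. the
anti-fixed one, `σ_w ϖ = −ϖ`, ★ `RamifiedPlaceAntiFixedUniformizer`), `U₂ = U(Φ₂)(L⁺_v) ≃ U(σ_w, Φ₂)(L_w)` (★ `localNonsplitEquiv`), levels `C ↔ GL₂(𝒪_w)` (the
EDGE-MIDPOINT stabiliser of the barycentric tree: self-dual `𝒪_w²`), `C′ ↔ d GL₂(𝒪_w) d⁻¹` (`d = diag(1, ϖ)`, the VERTEX stabiliser: `ϖ`-modular `latt d`), `I = C ∩ C′`.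
The three transitivities of `U(σ_w, Φ₂)` at a tamely ramified place are ★ A-p06 (g27): (hA) `forall_isSelfDualLattice_exists_latt_eq_of_ramified_antidiag`, (hI)
`forall_flag_exists_latt_eq_of_ramified` (over ★ B-p04 `forall_flag_exists_latt_eq_of_rootStar`: the star of the root has the two points `latt diag(1,ϖ)`,
`latt diag(ϖ,1)`), (hB) `forall_isModularLattice_exists_latt_mul_eq_of_ramified` ((hB) ⟸ (hI) by the parent); fed into ★ B-p08 (g28)'s place-blind
`natCard_fixedBy_add_eq_natCard_fixedBy_add_one_of_transitive` (★ A-p17 (T3)∕(T4) on `U(σ_w, Φ₂)(L_w)`) they give (E) for every `γ ∈ U₂` with the three finiteness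
inputs, and those hold for every REGULAR `γ` with COMPACT centraliser (closed class ★ `isClosed_conjClass_local_of_isRegularElt`; ★ B-p04
`finite_fixedBy_quotient_and_of_isClosed`) as soon as `C, C′` are compact open.

* §1 **`natCard_fixedBy_add_eq_natCard_fixedBy_add_one_of_finite_of_ramified`** — (E) on `U₂` at a tamely ramified place, hypothesis form `(C C′ I) (hC hC′ hI′)`,
  modulo the three finiteness binders (the ramified twin of ★ `…_of_finite`).
* §2 **`natCard_fixedBy_add_eq_natCard_fixedBy_add_one_of_isRegularElt_of_ramified`** — the same for every regular `γ` with compact centraliser, given `C, C′`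
  compact open (finiteness discharged) — the shape B-p14 (g32)'s «EP-RAM-PKG» `hE` consumes at `(C, C′) = (K, K♯)` after `add_comm`.

## References
* [Kottwitz1988] R. E. Kottwitz, *Tamagawa numbers*, Ann. of Math. 127 (1988), 629–646, §2 Theorem 2 (Euler–Poincaré functions; the fixed subtree).
* [BruhatTits1972] F. Bruhat, J. Tits, *Groupes réductifs sur un corps local I*, Publ. IHÉS 41 (1972), §10 (rank one; the barycentric subdivision at a ramified torus).
* [Jacobowitz1962] R. Jacobowitz, *Hermitian forms over local fields*, Amer. J. Math. 84 (1962), §8 (ramified `𝔭`-modular lattices).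
* [Serre1980Trees] J.-P. Serre, *Trees* (1980), Ch. I §6.1, Ch. II §1.1.
-/

set_option autoImplicit false

noncomputable section

open scoped ValuativeRel Matrix MatrixGroups
open Matrix ValuativeRel NumberField IsDedekindDomain MulAction

namespace Literature.NumberTheory.Automorphic.UnitaryGroup

open Literature.NumberTheory.Automorphic.HermitianLatticeTree Literature.NumberTheory.Rogawski1990

section CM

variable (L : Type) [Field L] [NumberField L] [IsCMField L] (v : HeightOneSpectrum (𝓞 ↥(maximalRealSubfield L)))
  (w : PlacesOver L v) (hw : IsCMField.complexConj L • w.1 = w.1)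

omit [IsCMField L] in
/-- `↑(glDiagonal ![1, ϖ]) = diagonal ![1, ↑ϖ]`. [cite: Serre1980Trees, II.1.1] -/
private theorem coe_glDiagonal_one_unit' (ϖ : (w.1.adicCompletion L)ˣ) :
    ((glDiagonal 2 (w.1.adicCompletion L) ![1, ϖ] : GL (Fin 2) (w.1.adicCompletion L)) : Matrix (Fin 2) (Fin 2) (w.1.adicCompletion L)) =
      Matrix.diagonal ![(1 : (w.1.adicCompletion L)), (ϖ : (w.1.adicCompletion L))] := by
  rw [coe_glDiagonal]
  congr 1
  funext i
  fin_cases i <;> rfl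

include hw in
/-- **KOTTWITZ'S ELLIPTIC RELATION `V_C + V_{C′} = E + 1` ON `U₂` AT A TAMELY RAMIFIED PLACE — TYPE-BLIND** (★ A-p17 (T4) at `(Φ₂)_w`, through ★ B-p08's place-blind
`…_of_transitive` with A-p06's ramified (hA)(hB)(hI)).  At a finite place `v` non-split and RAMIFIED in `L` (`e(w|v) ≠ 1`) with `2 ∈ 𝒪_w^×`, with `ϖ ∈ L_w^×` ANY
uniformiser, for subgroups `C, C′, I ≤ U₂` characterised at `w` by `GL₂(𝒪_w)`, `d GL₂(𝒪_w) d⁻¹` (`d = diag(1, ϖ)`) and `I = C ∩ C′`, and for every `γ ∈ U₂` whose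
fixed sets in `U₂ ⧸ C`, `U₂ ⧸ C′` and whose `⟨γ⟩`-orbit of the base coset are finite: `#Fix(U₂ ⧸ C, γ) + #Fix(U₂ ⧸ C′, γ) = #Fix(U₂ ⧸ I, γ) + 1`.
[cite: Kottwitz1988, §2 Theorem 2] [cite: BruhatTits1972, §10] [cite: Jacobowitz1962, §8] -/
theorem natCard_fixedBy_add_eq_natCard_fixedBy_add_one_of_finite_of_ramified
    (he : v.asIdeal.ramificationIdx' w.1.asIdeal ≠ 1) (h2 : IsUnit (2 : 𝒪[(w.1.adicCompletion L)]))
    (ϖ : (w.1.adicCompletion L)ˣ) (hϖ : Valued.v (ϖ : (w.1.adicCompletion L)) = WithZero.exp (-1 : ℤ))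
    (C C' I : Subgroup ((cmDatum L 2 (Matrix.of fun i j : Fin 2 => if i.val + j.val + 1 = 2 then (1 : L) else 0)).Local v))
    (hC : ∀ g, g ∈ C ↔ (((localNonsplitEquiv (IsCMField.complexConj L) (Matrix.of fun i j : Fin 2 => if i.val + j.val + 1 = 2 then (1 : L) else 0)
      (IsCMField.complexConj_ne_one L) w hw) g : ↥(unitaryGroupOfForm (galAdicCompletionMap (L := L) (IsCMField.complexConj L) hw)
        (placeForm (Matrix.of fun i j : Fin 2 => if i.val + j.val + 1 = 2 then (1 : L) else 0) w.1))) : GL (Fin 2) (w.1.adicCompletion L)) ∈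
        glInt 2 (w.1.adicCompletion L))
    (hC' : ∀ g, g ∈ C' ↔ (((localNonsplitEquiv (IsCMField.complexConj L) (Matrix.of fun i j : Fin 2 => if i.val + j.val + 1 = 2 then (1 : L) else 0)
      (IsCMField.complexConj_ne_one L) w hw) g : ↥(unitaryGroupOfForm (galAdicCompletionMap (L := L) (IsCMField.complexConj L) hw)
        (placeForm (Matrix.of fun i j : Fin 2 => if i.val + j.val + 1 = 2 then (1 : L) else 0) w.1))) : GL (Fin 2) (w.1.adicCompletion L)) ∈
        (glInt 2 (w.1.adicCompletion L)).map (MulAut.conj (glDiagonal 2 (w.1.adicCompletion L) ![1, ϖ])).toMonoidHom)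
    (hI' : ∀ g, g ∈ I ↔ g ∈ C ∧ g ∈ C')
    (γ : ((cmDatum L 2 (Matrix.of fun i j : Fin 2 => if i.val + j.val + 1 = 2 then (1 : L) else 0)).Local v))
    (hCfin : (fixedBy (((cmDatum L 2 (Matrix.of fun i j : Fin 2 => if i.val + j.val + 1 = 2 then (1 : L) else 0)).Local v) ⧸ C) γ).Finite)
    (hC'fin : (fixedBy (((cmDatum L 2 (Matrix.of fun i j : Fin 2 => if i.val + j.val + 1 = 2 then (1 : L) else 0)).Local v) ⧸ C') γ).Finite)
    (horb : (Set.range fun n : ℕ => ((γ ^ n : ((cmDatum L 2 (Matrix.of fun i j : Fin 2 => if i.val + j.val + 1 = 2 then (1 : L) else 0)).Local v)) :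
      ((cmDatum L 2 (Matrix.of fun i j : Fin 2 => if i.val + j.val + 1 = 2 then (1 : L) else 0)).Local v) ⧸ C)).Finite) :
    Nat.card (fixedBy (((cmDatum L 2 (Matrix.of fun i j : Fin 2 => if i.val + j.val + 1 = 2 then (1 : L) else 0)).Local v) ⧸ C) γ) +
        Nat.card (fixedBy (((cmDatum L 2 (Matrix.of fun i j : Fin 2 => if i.val + j.val + 1 = 2 then (1 : L) else 0)).Local v) ⧸ C') γ) =
      Nat.card (fixedBy (((cmDatum L 2 (Matrix.of fun i j : Fin 2 => if i.val + j.val + 1 = 2 then (1 : L) else 0)).Local v) ⧸ I) γ) + 1 := by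
  classical
  have hc1 : IsCMField.complexConj L ≠ 1 := IsCMField.complexConj_ne_one L
  have hϖ' : IsUniformizingElement (ϖ : (w.1.adicCompletion L)) := isUniformizingElement_of_v_eq hϖ
  haveI : IsDiscreteValuationRing 𝒪[(w.1.adicCompletion L)] := isDiscreteValuationRing_integer_of_compatible hϖ
  have hH2 : placeForm (Matrix.of fun i j : Fin 2 => if i.val + j.val + 1 = 2 then (1 : L) else 0) w.1 =
      (!![0, 1; 1, 0] : Matrix (Fin 2) (Fin 2) (w.1.adicCompletion L)) := placeForm_antidiagTwo_eq_antidiag L v w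
  have hd := coe_glDiagonal_one_unit' L v w ϖ
  -- A-p06's three ramified transitivities, read at `(Φ₂)_w = antidiag(1,1)`
  have hA : ∀ M : Submodule 𝒪[(w.1.adicCompletion L)] (Fin 2 → (w.1.adicCompletion L)),
      IsSelfDualLattice (galAdicCompletionMap (L := L) (IsCMField.complexConj L) hw) (placeForm (Matrix.of fun i j : Fin 2 => if i.val + j.val + 1 = 2 then (1 : L) else 0) w.1) M →
      ∃ u : ↥(unitaryGroupOfForm (galAdicCompletionMap (L := L) (IsCMField.complexConj L) hw) (placeForm (Matrix.of fun i j : Fin 2 => if i.val + j.val + 1 = 2 then (1 : L) else 0) w.1)),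
        latt (((u : GL (Fin 2) (w.1.adicCompletion L))) : Matrix (Fin 2) (Fin 2) (w.1.adicCompletion L)) = M := by
    rw [hH2]; exact forall_isSelfDualLattice_exists_latt_eq_of_ramified_antidiag (IsCMField.complexConj L) w hc1 hw he h2
  have hI : ∀ M N : Submodule 𝒪[(w.1.adicCompletion L)] (Fin 2 → (w.1.adicCompletion L)),
      IsSelfDualLattice (galAdicCompletionMap (L := L) (IsCMField.complexConj L) hw) (placeForm (Matrix.of fun i j : Fin 2 => if i.val + j.val + 1 = 2 then (1 : L) else 0) w.1) M →
      IsModularLattice (galAdicCompletionMap (L := L) (IsCMField.complexConj L) hw) (ϖ : (w.1.adicCompletion L)) (placeForm (Matrix.of fun i j : Fin 2 => if i.val + j.val + 1 = 2 then (1 : L) else 0) w.1) N →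
      scaleLattice (ϖ : (w.1.adicCompletion L)) M ≤ N → N ≤ M →
      ∃ u : ↥(unitaryGroupOfForm (galAdicCompletionMap (L := L) (IsCMField.complexConj L) hw) (placeForm (Matrix.of fun i j : Fin 2 => if i.val + j.val + 1 = 2 then (1 : L) else 0) w.1)),
        latt (((u : GL (Fin 2) (w.1.adicCompletion L))) : Matrix (Fin 2) (Fin 2) (w.1.adicCompletion L)) = M ∧
        latt (((u : GL (Fin 2) (w.1.adicCompletion L)) * (glDiagonal 2 (w.1.adicCompletion L) ![1, ϖ]) : GL (Fin 2) (w.1.adicCompletion L)) : Matrix (Fin 2) (Fin 2) (w.1.adicCompletion L)) = N := by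
    rw [hH2]; exact forall_flag_exists_latt_eq_of_ramified (IsCMField.complexConj L) w hc1 hw he h2 hϖ' hd
  have hB : ∀ M : Submodule 𝒪[(w.1.adicCompletion L)] (Fin 2 → (w.1.adicCompletion L)),
      IsModularLattice (galAdicCompletionMap (L := L) (IsCMField.complexConj L) hw) (ϖ : (w.1.adicCompletion L)) (placeForm (Matrix.of fun i j : Fin 2 => if i.val + j.val + 1 = 2 then (1 : L) else 0) w.1) M →
      ∃ u : ↥(unitaryGroupOfForm (galAdicCompletionMap (L := L) (IsCMField.complexConj L) hw) (placeForm (Matrix.of fun i j : Fin 2 => if i.val + j.val + 1 = 2 then (1 : L) else 0) w.1)),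
        latt (((u : GL (Fin 2) (w.1.adicCompletion L)) * (glDiagonal 2 (w.1.adicCompletion L) ![1, ϖ]) : GL (Fin 2) (w.1.adicCompletion L)) : Matrix (Fin 2) (Fin 2) (w.1.adicCompletion L)) = M := by
    rw [hH2]; exact forall_isModularLattice_exists_latt_mul_eq_of_ramified (IsCMField.complexConj L) w hc1 hw he h2 hϖ' hd
  exact natCard_fixedBy_add_eq_natCard_fixedBy_add_one_of_transitive L v w hw ϖ hϖ C C' I hC hC' hI' hA hB hI γ hCfin hC'fin horb

include hw in
/-- **(E) AT A TAMELY RAMIFIED PLACE FOR EVERY REGULAR `γ` WITH COMPACT CENTRALISER, at compact open levels `C, C′`** (`C ↔ GL₂(𝒪_w)`, `C′ ↔ d GL₂(𝒪_w) d⁻¹`,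
`I = C ∩ C′`): the three finiteness binders of `…_of_finite_of_ramified` discharged by ★ `finite_fixedBy_quotient_and_of_isClosed` (class closed ★
`isClosed_conjClass_local_of_isRegularElt`).  With `(C, C′) = (K_w, K♯_w)` and `add_comm` this is the `hE` binder of «EP-RAM-PKG» (B-p14 (g32)).
[cite: Kottwitz1988, §2 Theorem 2] [cite: BruhatTits1972, §10] -/
theorem natCard_fixedBy_add_eq_natCard_fixedBy_add_one_of_isRegularElt_of_ramified
    (he : v.asIdeal.ramificationIdx' w.1.asIdeal ≠ 1) (h2 : IsUnit (2 : 𝒪[(w.1.adicCompletion L)]))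
    (ϖ : (w.1.adicCompletion L)ˣ) (hϖ : Valued.v (ϖ : (w.1.adicCompletion L)) = WithZero.exp (-1 : ℤ))
    (C C' I : Subgroup ((cmDatum L 2 (Matrix.of fun i j : Fin 2 => if i.val + j.val + 1 = 2 then (1 : L) else 0)).Local v))
    (hC : ∀ g, g ∈ C ↔ (((localNonsplitEquiv (IsCMField.complexConj L) (Matrix.of fun i j : Fin 2 => if i.val + j.val + 1 = 2 then (1 : L) else 0)
      (IsCMField.complexConj_ne_one L) w hw) g : ↥(unitaryGroupOfForm (galAdicCompletionMap (L := L) (IsCMField.complexConj L) hw)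
        (placeForm (Matrix.of fun i j : Fin 2 => if i.val + j.val + 1 = 2 then (1 : L) else 0) w.1))) : GL (Fin 2) (w.1.adicCompletion L)) ∈
        glInt 2 (w.1.adicCompletion L))
    (hC' : ∀ g, g ∈ C' ↔ (((localNonsplitEquiv (IsCMField.complexConj L) (Matrix.of fun i j : Fin 2 => if i.val + j.val + 1 = 2 then (1 : L) else 0)
      (IsCMField.complexConj_ne_one L) w hw) g : ↥(unitaryGroupOfForm (galAdicCompletionMap (L := L) (IsCMField.complexConj L) hw)
        (placeForm (Matrix.of fun i j : Fin 2 => if i.val + j.val + 1 = 2 then (1 : L) else 0) w.1))) : GL (Fin 2) (w.1.adicCompletion L)) ∈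
        (glInt 2 (w.1.adicCompletion L)).map (MulAut.conj (glDiagonal 2 (w.1.adicCompletion L) ![1, ϖ])).toMonoidHom)
    (hI' : ∀ g, g ∈ I ↔ g ∈ C ∧ g ∈ C')
    (hCo : IsOpen (C : Set ((cmDatum L 2 (Matrix.of fun i j : Fin 2 => if i.val + j.val + 1 = 2 then (1 : L) else 0)).Local v)))
    (hCc : IsCompact (C : Set ((cmDatum L 2 (Matrix.of fun i j : Fin 2 => if i.val + j.val + 1 = 2 then (1 : L) else 0)).Local v)))
    (hC'o : IsOpen (C' : Set ((cmDatum L 2 (Matrix.of fun i j : Fin 2 => if i.val + j.val + 1 = 2 then (1 : L) else 0)).Local v)))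
    (hC'c : IsCompact (C' : Set ((cmDatum L 2 (Matrix.of fun i j : Fin 2 => if i.val + j.val + 1 = 2 then (1 : L) else 0)).Local v)))
    (γ : ((cmDatum L 2 (Matrix.of fun i j : Fin 2 => if i.val + j.val + 1 = 2 then (1 : L) else 0)).Local v))
    (hreg : IsRegularElt (γ.val : GL (Fin 2) (UnitaryGroup.LocalRing L v)))
    (hc : CompactSpace (Subgroup.centralizer ({γ} : Set ((cmDatum L 2 (Matrix.of fun i j : Fin 2 => if i.val + j.val + 1 = 2 then (1 : L) else 0)).Local v)))) :
    Nat.card (fixedBy (((cmDatum L 2 (Matrix.of fun i j : Fin 2 => if i.val + j.val + 1 = 2 then (1 : L) else 0)).Local v) ⧸ C) γ) +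
        Nat.card (fixedBy (((cmDatum L 2 (Matrix.of fun i j : Fin 2 => if i.val + j.val + 1 = 2 then (1 : L) else 0)).Local v) ⧸ C') γ) =
      Nat.card (fixedBy (((cmDatum L 2 (Matrix.of fun i j : Fin 2 => if i.val + j.val + 1 = 2 then (1 : L) else 0)).Local v) ⧸ I) γ) + 1 := by
  haveI := hc
  have hO := isClosed_conjClass_local_of_isRegularElt L 2 (Matrix.of fun i j : Fin 2 => if i.val + j.val + 1 = 2 then (1 : L) else 0) v
    (antidiagOne_isHermitian L 2) (isUnit_antidiagOne_det L 2).ne_zero γ hreg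
  obtain ⟨hCfin, hC'fin, horb⟩ := finite_fixedBy_quotient_and_of_isClosed γ hO C C' hCo hCc hC'o hC'c
  exact natCard_fixedBy_add_eq_natCard_fixedBy_add_one_of_finite_of_ramified L v w hw he h2 ϖ hϖ C C' I hC hC' hI' γ hCfin hC'fin horb

end CM

end Literature.NumberTheory.Automorphic.UnitaryGroup

end
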